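import Literature.AlgebraicGeometry.HodgeTheory.DiagonalSymmetryEigenHodgeNumbers
import Literature.AlgebraicGeometry.HodgeTheory.CompleteIntersectionHilbertFunction
import Mathlib.RingTheory.MvPolynomial.Ideal
import Mathlib.RingTheory.MvPolynomial.Basic
import HarnessLib

/-!
# The equivariant Hilbert function of the Jacobian ring of a form with a diagonal symmetry
# (Macaulay / Carlson–Müller-Stach–Peters Thm. 7.4.1, refined by the characters of the symmetry)

Family `hodge`, layer `Literature/AlgebraicGeometry/HodgeTheory`. THEOREMS ONLY (0 named facts, 0 sorry).
Sequel of `DiagonalSymmetryEigenHodgeNumbers` (eigen-Hodge numbers of a diagonal symmetry `a` of a smooth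
hypersurface `Y = V₊(F)` = `dim (S_k)_μ − dim ((J_F)_k)_μ`, the `μ`-eigen-parts of the twisted action
`T_a P = (∏ aᵢ) P(a • x)` on the forms of degree `k` and on the Jacobian ideal) and of
`CompleteIntersectionHilbertFunction` (the Hilbert function of an Artinian complete intersection depends
only on the degrees: Carlson–Müller-Stach–Peters Thm. 7.4.1, Voisin II Def. 6.18 / Thm. 6.19, by the
non-zero-divisor recursion of Philippon's Lemme 3.1). Here that recursion is run CHARACTER BY CHARACTER:

* §1–§3 (algebra of the twisted action, all proved): `χ_a(e + e') = w_a(e) χ_a(e')` with the plain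
  weight `w_a(e) = ∏ aᵢ^{eᵢ}`; products of eigenvectors `E_α · E_θ ⊆ E_{αθ/∏aᵢ}`; coefficients and
  linearity of the eigen-components `P_μ`; `(g Q)_μ = g_{μ∏aᵢ/θ} Q` for `Q ∈ E_θ`; an ideal generated by
  `T_a`-eigenvectors contains the eigen-components of its elements (`eigenComponent_mem_span_of_eigen`).
* §4 **the refined non-zero-divisor formula** `finrank_part_idealDegree_sup_span_add_eq`: for `I`
  generated by homogeneous eigen-forms and `Q ∈ E_θ` a form of degree `q`, non-zero and a
  non-zero-divisor modulo `I`: `dim ((I + (Q))_{t+q})_μ + dim (I_t)_κ = dim (I_{t+q})_μ + dim (S_t)_κ`,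
  `κ = μ∏aᵢ/θ` (the exact sequence `0 → (S/I)_{t,κ} →·Q (S/I)_{t+q,μ} → (S/(I,Q))_{t+q,μ} → 0`).
* §5 **square systems** `G_0, …, G_{m+1}` of eigen-forms in `m + 2` variables with finite quotient
  (hence a regular sequence, tree `mem_ofList_take_of_mul_mem`, Matsumura 17.4): the refined Hilbert
  function `(t, μ) ↦ dim (S_t)_μ − dim ((G)_t)_μ` depends only on the degrees and the characters
  (`refinedHilbert_span_eq_of_X_pow_mem`).
* §6 the monomial complete intersection `(x_i^e)`: its eigen-parts are coordinate subspaces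
  (`restrictSupport`), so `dim (S_t)_μ − dim ((x^e)_t)_μ = #{β : |β| = t, β_i ≤ e−1, χ_a(β) = μ}`
  (`refinedHilbert_span_X_pow_eq_card`).
* §7 **`refinedHilbert_jacobianIdeal_eq_card`**: for a form `F` of degree `d ≥ 2` with finite-dimensional
  Jacobian ring, invariant under `a` with `aᵢ^d = 1` (so that `∂ᵢF` and `xᵢ^{d−1}` have the same
  character `(∏aⱼ)aᵢ⁻¹`): `dim (S_t)_μ − dim ((J_F)_t)_μ = #{β ∈ [0,d−2]^{n+2} : |β| = t, χ_a(β) = μ}` —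
  Movasati's `#I_t` split by characters.
* §8 nonsingular forms have finite-dimensional Jacobian rings (Euler's identity + Nullstellensatz;
  Voisin II §6.2.2), `exists_X_pow_mem_jacobianIdeal_of_isNonsingularForm`.
* §9 **the sign involution `ι = (−1,−1,1,1,1)` of a quinary form** (route `SignSymmetricPowers`, K1 line
  `andre-zariski`, stub `stub_signDeckHodge`): `refinedHilbert_jacobianIdeal_sign_eq_card` and, with the
  companion file, **`finrank_signEigenspace_inf_piece_eq_card`**: granted the cited kernel package
  `Griffiths1969_residueKernel_eq_jacobianIdeal` (Voisin II Thm. 6.10 / Cor. 6.12), for a nonsingular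
  `ι`-invariant `f` of even degree `d`, `k + 5 = (q+1)d`:
  `dim_ℂ (ker(σ^* ⊗ ℂ − (−1)^j) ∩ H^{3−q,q}(X_f)) = #{β ∈ [0,d−2]⁵ : |β| = k, β₀ + β₁ ≡ j (mod 2)}`,
  the coefficient of `t^k s^j` in `(Σ_{i<d−1}(st)^i)² (Σ_{i<d−1} t^i)³` (the stub's `shn d j q`).

Relation to `CompleteIntersectionHilbertFunctionSign` (cell `hodge-nonav`, prover seat B, landed the same
morning): that file treats the INVOLUTION case (`a² = 1`, eigenvalues `±1` of the plain substitution
`P ↦ P(a • x)`, via the projectors `½(1 ± ι)`) and stops before symmetries of higher order; the present file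
works with the twisted action `T_a` of `DiagonalSymmetryEigenHodgeNumbers` and ARBITRARY characters
(eigen-components instead of projectors, so any finite or infinite order), and assembles the count with the
Hodge-theoretic theorem of that companion (`finrank_signEigenspace_inf_piece_eq_card`, §9). For the sign
involution `∏ ιᵢ = 1`, so `T_ι = ι^*` and `refinedHilbert_jacobianIdeal_sign_eq_card` is the parity instance of
both files' box counts.

Sources (as in the two predecessor files): J. Carlson, S. Müller-Stach, C. Peters, *Period Mappings and
Period Domains* (2nd ed.) §7.4 Thm. 7.4.1 and its proof ("the standard example [of a regular sequence]
is the sequence of the partial derivatives of a smooth hypersurface"); P. Philippon, Bull. SMF 114 (1986)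
Lemme 3.1; C. Voisin, *Hodge Theory II* §6.1.3 Def. 6.9, §6.2.2; H. Movasati, arXiv:1602.06607 Def. 1
(`#I_N`); T. Shioda, Math. Ann. 245 (1979) §1 (characters of monomials). The character refinement is the
bookkeeping of Shioda / Carlson–Toledo §5 for a diagonal symmetry; no statement beyond these is claimed.

## References

* [CarlsonMullerStachPeters2017] J. Carlson, S. Müller-Stach, C. Peters, Period Mappings and Period
  Domains, 2nd ed., CUP 2017, §7.4 Thm. 7.4.1 (pp. 219–220).
* [Philippon1986] P. Philippon, Lemmes de zéros dans les groupes algébriques commutatifs, Bull. SMF 114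
  (1986), Lemme 3.1.
* [VoisinHodgeII2003] C. Voisin, Hodge Theory and Complex Algebraic Geometry II, CUP 2003, §6.1.3
  Def. 6.9, Thm. 6.10, Cor. 6.12, §6.2.2 (held text chunks p0159–p0161, p0165).
* [Movasati2016Periods] H. Movasati, Why should one compute periods of algebraic cycles?,
  arXiv:1602.06607, Definition 1.
* [Shioda1979HodgeFermat] T. Shioda, The Hodge conjecture for Fermat varieties, Math. Ann. 245 (1979), §1 (1.7).
* [Matsumura1987] H. Matsumura, Commutative Ring Theory, Thm. 17.4.
-/

noncomputable section

open CategoryTheory AlgebraicGeometry MvPolynomial Module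
open scoped TensorProduct

namespace Literature.AlgebraicGeometry.HodgeTheory

open Literature.AlgebraicGeometry.Motives Literature.AlgebraicTopology.SingularHomology
open Literature.RingTheory.MvPolynomial (idealDegree mem_idealDegree)

section HodgeTheory

variable {n : ℕ}

/-! ### §1 The plain weight `∏ aᵢ^{eᵢ}` and products of eigenvectors -/

/-- The plain diagonal weight `w_a(e) = ∏ᵢ aᵢ^{eᵢ}` of the monomial `x^e` (the character of the
substitution `P ↦ P(a • x)`; `χ_a(e) = (∏ aᵢ) · w_a(e)`). [cite: Shioda1979HodgeFermat, §1 (1.7)] -/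
def diagonalWeight (a : Fin (n + 2) → ℂˣ) (e : Fin (n + 2) →₀ ℕ) : ℂ :=
  ∏ i, ((a i : ℂˣ) : ℂ) ^ (e i)

/-- Unfolding of `diagonalWeight`. [cite: Shioda1979HodgeFermat, §1 (1.7)] -/
theorem diagonalWeight_apply (a : Fin (n + 2) → ℂˣ) (e : Fin (n + 2) →₀ ℕ) :
    diagonalWeight a e = ∏ i, ((a i : ℂˣ) : ℂ) ^ (e i) := rfl

/-- `w_a(e + e') = w_a(e) w_a(e')`. [cite: Shioda1979HodgeFermat, §1 (1.7)] -/
theorem diagonalWeight_add (a : Fin (n + 2) → ℂˣ) (e e' : Fin (n + 2) →₀ ℕ) :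
    diagonalWeight a (e + e') = diagonalWeight a e * diagonalWeight a e' := by
  simp only [diagonalWeight_apply, Finsupp.add_apply, pow_add, Finset.prod_mul_distrib]

/-- `χ_a(e) = (∏ aᵢ) w_a(e)`. [cite: Shioda1979HodgeFermat, §1 (1.7)] -/
theorem diagonalCharacter_eq_prod_mul_diagonalWeight (a : Fin (n + 2) → ℂˣ) (e : Fin (n + 2) →₀ ℕ) :
    diagonalCharacter a e = (∏ i, ((a i : ℂˣ) : ℂ)) * diagonalWeight a e :=
  diagonalCharacter_eq_prod_mul a e

/-- `χ_a(e + e') = w_a(e) χ_a(e')`. [cite: Shioda1979HodgeFermat, §1 (1.7)] -/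
theorem diagonalCharacter_add (a : Fin (n + 2) → ℂˣ) (e e' : Fin (n + 2) →₀ ℕ) :
    diagonalCharacter a (e + e') = diagonalWeight a e * diagonalCharacter a e' := by
  rw [diagonalCharacter_eq_prod_mul_diagonalWeight, diagonalCharacter_eq_prod_mul_diagonalWeight,
    diagonalWeight_add]
  ring

/-- The scalar `∏ aᵢ` is non-zero. [cite: Shioda1979HodgeFermat, §1 (1.7)] -/
theorem prod_units_val_ne_zero (a : Fin (n + 2) → ℂˣ) : (∏ i, ((a i : ℂˣ) : ℂ)) ≠ 0 :=
  Finset.prod_ne_zero_iff.mpr fun _ _ ↦ Units.ne_zero _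

/-- Weights are non-zero. [cite: Shioda1979HodgeFermat, §1 (1.7)] -/
theorem diagonalWeight_ne_zero (a : Fin (n + 2) → ℂˣ) (e : Fin (n + 2) →₀ ℕ) : diagonalWeight a e ≠ 0 :=
  Finset.prod_ne_zero_iff.mpr fun _ _ ↦ pow_ne_zero _ (Units.ne_zero _)

/-- Characters are non-zero. [cite: Shioda1979HodgeFermat, §1 (1.7)] -/
theorem diagonalCharacter_ne_zero (a : Fin (n + 2) → ℂˣ) (e : Fin (n + 2) →₀ ℕ) :
    diagonalCharacter a e ≠ 0 := by
  rw [diagonalCharacter_eq_prod_mul_diagonalWeight]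
  exact mul_ne_zero (prod_units_val_ne_zero a) (diagonalWeight_ne_zero a e)

/-- In a `μ`-eigenvector every occurring monomial has weight `μ / ∏ aᵢ`. [cite: Shioda1979HodgeFermat, §1 (1.7)] -/
theorem diagonalWeight_eq_of_mem_eigenspace {a : Fin (n + 2) → ℂˣ} {μ : ℂ} {P : MvPolynomial (Fin (n + 2)) ℂ}
    (hP : P ∈ Module.End.eigenspace (twistedDiagonalAction a) μ) {e : Fin (n + 2) →₀ ℕ}
    (he : e ∈ P.support) : diagonalWeight a e = μ * (∏ i, ((a i : ℂˣ) : ℂ))⁻¹ := by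
  have h := (mem_eigenspace_twistedDiagonalAction_iff a μ P).mp hP e he
  rw [diagonalCharacter_eq_prod_mul_diagonalWeight] at h
  rw [← h, mul_comm, ← mul_assoc, inv_mul_cancel₀ (prod_units_val_ne_zero a), one_mul]

/-- **Products of eigenvectors**: if `P ∈ E_α(T_a)` and `Q ∈ E_θ(T_a)` then
`P Q ∈ E_{α θ / ∏ aᵢ}(T_a)` (`χ_a(e + e') = w_a(e) χ_a(e')`). [cite: Shioda1979HodgeFermat, §1 (1.7)] -/
theorem mul_mem_eigenspace_twistedDiagonalAction {a : Fin (n + 2) → ℂˣ} {α θ : ℂ}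
    {P Q : MvPolynomial (Fin (n + 2)) ℂ} (hP : P ∈ Module.End.eigenspace (twistedDiagonalAction a) α)
    (hQ : Q ∈ Module.End.eigenspace (twistedDiagonalAction a) θ) :
    P * Q ∈ Module.End.eigenspace (twistedDiagonalAction a) (α * (∏ i, ((a i : ℂˣ) : ℂ))⁻¹ * θ) := by
  classical
  rw [mem_eigenspace_twistedDiagonalAction_iff]
  intro e'' he''
  obtain ⟨e, he, e', he', rfl⟩ := Finset.mem_add.mp (support_mul P Q he'')
  rw [diagonalCharacter_add, diagonalWeight_eq_of_mem_eigenspace hP he,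
    (mem_eigenspace_twistedDiagonalAction_iff a θ Q).mp hQ e' he']

/-! ### §2 Eigen-components: coefficients, linearity, products -/

/-- Coefficients of the eigen-component: `(P_μ)_e = P_e` if `χ_a(e) = μ`, else `0`. [cite: Shioda1979HodgeFermat, §1 (1.7)] -/
theorem coeff_eigenComponent (a : Fin (n + 2) → ℂˣ) (μ : ℂ) (P : MvPolynomial (Fin (n + 2)) ℂ)
    (e : Fin (n + 2) →₀ ℕ) :
    coeff e (eigenComponent a μ P) = if diagonalCharacter a e = μ then coeff e P else 0 := by
  classical
  unfold eigenComponent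
  rw [coeff_sum]
  simp only [coeff_monomial]
  rw [Finset.sum_ite_eq']
  simp only [Finset.mem_filter, MvPolynomial.mem_support_iff]
  by_cases h : diagonalCharacter a e = μ
  · by_cases h0 : coeff e P = 0
    · simp [h, h0]
    · simp [h, h0]
  · simp [h]

/-- The eigen-component is additive. [cite: Shioda1979HodgeFermat, §1 (1.7)] -/
theorem eigenComponent_add (a : Fin (n + 2) → ℂˣ) (μ : ℂ) (P Q : MvPolynomial (Fin (n + 2)) ℂ) :
    eigenComponent a μ (P + Q) = eigenComponent a μ P + eigenComponent a μ Q := by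
  ext e
  simp only [coeff_eigenComponent, coeff_add]
  split_ifs <;> simp

/-- The eigen-component of a finite sum. [cite: Shioda1979HodgeFermat, §1 (1.7)] -/
theorem eigenComponent_sum {ι : Type*} (a : Fin (n + 2) → ℂˣ) (μ : ℂ) (s : Finset ι)
    (P : ι → MvPolynomial (Fin (n + 2)) ℂ) :
    eigenComponent a μ (∑ i ∈ s, P i) = ∑ i ∈ s, eigenComponent a μ (P i) := by
  classical
  induction s using Finset.induction_on with
  | empty =>
    rw [Finset.sum_empty, Finset.sum_empty]
    ext e
    rw [coeff_eigenComponent, coeff_zero]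
    split_ifs <;> rfl
  | insert i s hi ih => rw [Finset.sum_insert hi, Finset.sum_insert hi, eigenComponent_add, ih]

/-- An eigenvector is its own component, and has no other components:
`Q ∈ E_θ ⇒ Q_μ = Q` if `θ = μ`, `= 0` otherwise. [cite: Shioda1979HodgeFermat, §1 (1.7)] -/
theorem eigenComponent_of_mem_eigenspace {a : Fin (n + 2) → ℂˣ} {θ : ℂ} (μ : ℂ)
    {Q : MvPolynomial (Fin (n + 2)) ℂ} (hQ : Q ∈ Module.End.eigenspace (twistedDiagonalAction a) θ) :
    eigenComponent a μ Q = if θ = μ then Q else 0 := by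
  classical
  have hsupp := (mem_eigenspace_twistedDiagonalAction_iff a θ Q).mp hQ
  ext e
  rw [coeff_eigenComponent]
  by_cases h2 : θ = μ
  · rw [if_pos h2]
    by_cases h1 : diagonalCharacter a e = μ
    · rw [if_pos h1]
    · rw [if_neg h1]
      by_contra hne
      exact h1 ((hsupp e (MvPolynomial.mem_support_iff.mpr (Ne.symm hne))).trans h2)
  · rw [if_neg h2, coeff_zero]
    by_cases h1 : diagonalCharacter a e = μ
    · rw [if_pos h1]
      by_contra hne
      exact h2 ((hsupp e (MvPolynomial.mem_support_iff.mpr hne)).symm.trans h1)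
    · rw [if_neg h1]

/-- **Components of a product with an eigenvector**: for `Q ∈ E_θ(T_a)`, `θ ≠ 0`,
`(g Q)_μ = g_{μ (∏ aᵢ) θ⁻¹} · Q`. [cite: Shioda1979HodgeFermat, §1 (1.7)] -/
theorem eigenComponent_mul_of_mem_eigenspace {a : Fin (n + 2) → ℂˣ} {θ : ℂ} (hθ : θ ≠ 0) (μ : ℂ)
    (g : MvPolynomial (Fin (n + 2)) ℂ) {Q : MvPolynomial (Fin (n + 2)) ℂ}
    (hQ : Q ∈ Module.End.eigenspace (twistedDiagonalAction a) θ) :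
    eigenComponent a μ (g * Q) = eigenComponent a (μ * (∏ i, ((a i : ℂˣ) : ℂ)) * θ⁻¹) g * Q := by
  classical
  have hc0 : (∏ i, ((a i : ℂˣ) : ℂ)) ≠ 0 := prod_units_val_ne_zero a
  conv_lhs => rw [← sum_eigenComponent a g, Finset.sum_mul, eigenComponent_sum]
  have hterm : ∀ ν ∈ g.support.image (diagonalCharacter a), eigenComponent a μ (eigenComponent a ν g * Q) =
      if ν = μ * (∏ i, ((a i : ℂˣ) : ℂ)) * θ⁻¹ then eigenComponent a ν g * Q else 0 := by
    intro ν _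
    rw [eigenComponent_of_mem_eigenspace μ
      (mul_mem_eigenspace_twistedDiagonalAction (eigenComponent_mem_eigenspace a ν g) hQ)]
    by_cases h : ν = μ * (∏ i, ((a i : ℂˣ) : ℂ)) * θ⁻¹
    · rw [if_pos h, if_pos]
      rw [h]; field_simp
    · rw [if_neg h, if_neg]
      intro h'
      apply h
      rw [← h']; field_simp
  rw [Finset.sum_congr rfl hterm, Finset.sum_ite_eq']
  split_ifs with hmem
  · rfl
  · rw [eigenComponent_eq_zero_of_not_mem a hmem, zero_mul]

/-! ### §3 Ideals generated by eigenvectors are closed under eigen-components -/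

/-- **An ideal generated by `T_a`-eigenvectors contains the eigen-components of its elements**
(the ideal is "homogeneous" for the grading by characters). [cite: VoisinHodgeII2003, §6.1.3 Def. 6.9 (held text chunk p0159)] -/
theorem eigenComponent_mem_span_of_eigen {a : Fin (n + 2) → ℂˣ} {S : Set (MvPolynomial (Fin (n + 2)) ℂ)}
    (hS : ∀ Q ∈ S, ∃ θ, Q ∈ Module.End.eigenspace (twistedDiagonalAction a) θ)
    {P : MvPolynomial (Fin (n + 2)) ℂ} (hP : P ∈ Ideal.span S) (μ : ℂ) :
    eigenComponent a μ P ∈ Ideal.span S := by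
  classical
  revert μ
  refine Submodule.span_induction (p := fun P _ ↦ ∀ μ, eigenComponent a μ P ∈ Ideal.span S) ?_ ?_ ?_ ?_ hP
  · intro Q hQ μ
    obtain ⟨θ, hθ⟩ := hS Q hQ
    rw [eigenComponent_of_mem_eigenspace μ hθ]
    split_ifs
    · exact Ideal.subset_span hQ
    · exact Submodule.zero_mem _
  · intro μ
    rw [eigenComponent_of_mem_eigenspace μ (Submodule.zero_mem (Module.End.eigenspace (twistedDiagonalAction a) μ)),
      if_pos rfl]
    exact Submodule.zero_mem _
  · intro x y _ _ hx hy μ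
    rw [eigenComponent_add]
    exact Submodule.add_mem _ (hx μ) (hy μ)
  · intro r x _ hx μ
    rw [smul_eq_mul, ← sum_eigenComponent a x, Finset.mul_sum, eigenComponent_sum]
    refine Submodule.sum_mem _ fun κ hκ ↦ ?_
    have hκ0 : κ ≠ 0 := by
      obtain ⟨e, _, rfl⟩ := Finset.mem_image.mp hκ
      exact diagonalCharacter_ne_zero a e
    rw [eigenComponent_mul_of_mem_eigenspace hκ0 μ r (eigenComponent_mem_eigenspace a κ x)]
    exact Ideal.mul_mem_left _ _ (hx κ)

/-! ### §4 The refined hypersurface-section formula (Philippon's Lemme 3.1 by characters) -/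

/-- **`((I + (Q))_{t+q})_μ = (I_{t+q})_μ + Q · (S_t)_{μ ∏aᵢ / θ}`** for an ideal `I` generated by
homogeneous `T_a`-eigenvectors and a form `Q ∈ E_θ(T_a)` of degree `q` (refines the tree's
`idealDegree_sup_span_singleton`). [cite: Philippon1986, Lemme 3.1] -/
theorem part_idealDegree_sup_span_singleton {a : Fin (n + 2) → ℂˣ}
    {S : Set (MvPolynomial (Fin (n + 2)) ℂ)}
    (hSe : ∀ Q ∈ S, ∃ θ, Q ∈ Module.End.eigenspace (twistedDiagonalAction a) θ)
    (hSh : ∀ Q ∈ S, ∃ k, Q.IsHomogeneous k)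
    {Q : MvPolynomial (Fin (n + 2)) ℂ} {q : ℕ} (hQ : Q.IsHomogeneous q) {θ : ℂ} (hθ : θ ≠ 0)
    (hQθ : Q ∈ Module.End.eigenspace (twistedDiagonalAction a) θ) (t : ℕ) (μ : ℂ) :
    Module.End.eigenspace (twistedDiagonalAction a) μ ⊓ idealDegree (Ideal.span S ⊔ Ideal.span {Q}) (t + q) =
      (Module.End.eigenspace (twistedDiagonalAction a) μ ⊓ idealDegree (Ideal.span S) (t + q)) ⊔
        (Module.End.eigenspace (twistedDiagonalAction a) (μ * (∏ i, ((a i : ℂˣ) : ℂ)) * θ⁻¹) ⊓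
          homogeneousSubmodule (Fin (n + 2)) ℂ t).map (LinearMap.mulLeft ℂ Q) := by
  classical
  letI : GradedRing (homogeneousSubmodule (Fin (n + 2)) ℂ) := MvPolynomial.gradedAlgebra
  have hI : (Ideal.span S).IsHomogeneous (homogeneousSubmodule (Fin (n + 2)) ℂ) :=
    Ideal.homogeneous_span _ _ fun Q hQ ↦ hSh Q hQ
  have hc0 : (∏ i, ((a i : ℂˣ) : ℂ)) ≠ 0 := prod_units_val_ne_zero a
  apply le_antisymm
  · rintro f ⟨hfμ, hf⟩
    rw [Literature.RingTheory.MvPolynomial.idealDegree_sup_span_singleton hI hQ t] at hf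
    obtain ⟨i, hi, _, ⟨r, hr, rfl⟩, rfl⟩ := Submodule.mem_sup.mp hf
    -- `f = f_μ = i_μ + (Q r)_μ = i_μ + Q r_{μ c / θ}`
    have hf_eq : i + LinearMap.mulLeft ℂ Q r =
        eigenComponent a μ i + Q * eigenComponent a (μ * (∏ i, ((a i : ℂˣ) : ℂ)) * θ⁻¹) r := by
      have h := eigenComponent_of_mem_eigenspace μ hfμ
      rw [if_pos rfl, eigenComponent_add] at h
      conv_lhs => rw [← h]
      rw [LinearMap.mulLeft_apply, mul_comm Q r, eigenComponent_mul_of_mem_eigenspace hθ μ r hQθ, mul_comm]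
    rw [hf_eq]
    refine Submodule.add_mem_sup ⟨eigenComponent_mem_eigenspace a μ i, ?_, ?_⟩
      ⟨eigenComponent a (μ * (∏ i, ((a i : ℂˣ) : ℂ)) * θ⁻¹) r,
        ⟨eigenComponent_mem_eigenspace a _ r, eigenComponent_mem_homogeneousSubmodule a _ hr⟩, rfl⟩
    · exact eigenComponent_mem_span_of_eigen hSe hi.1 μ
    · exact eigenComponent_mem_homogeneousSubmodule a μ hi.2
  · refine sup_le (inf_le_inf_left _ (Literature.RingTheory.MvPolynomial.idealDegree_mono le_sup_left _)) ?_
    rintro _ ⟨r, ⟨hrκ, hrt⟩, rfl⟩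
    refine ⟨?_, ?_, ?_⟩
    · rw [SetLike.mem_coe, LinearMap.mulLeft_apply, mul_comm]
      have h := mul_mem_eigenspace_twistedDiagonalAction hrκ hQθ
      have hval : μ * (∏ i, ((a i : ℂˣ) : ℂ)) * θ⁻¹ * (∏ i, ((a i : ℂˣ) : ℂ))⁻¹ * θ = μ := by field_simp
      rwa [hval] at h
    · exact Ideal.mem_sup_right (Ideal.mem_span_singleton'.mpr ⟨r, (mul_comm r Q).trans rfl⟩)
    · rw [LinearMap.mulLeft_apply]
      simpa [add_comm] using hQ.mul (show r.IsHomogeneous t from hrt)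

/-- With `Q` a non-zero-divisor modulo `I = (S)`: `(I_{t+q})_μ ∩ Q · (S_t)_κ = Q · (I_t)_κ`. [cite: Philippon1986, Lemme 3.1] -/
theorem part_idealDegree_inf_map_mulLeft_eq {a : Fin (n + 2) → ℂˣ} {I : Ideal (MvPolynomial (Fin (n + 2)) ℂ)}
    {Q : MvPolynomial (Fin (n + 2)) ℂ} {q : ℕ} (hQ : Q.IsHomogeneous q) {θ : ℂ}
    (hQθ : Q ∈ Module.End.eigenspace (twistedDiagonalAction a) θ) (hnzd : ∀ f, Q * f ∈ I → f ∈ I)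
    (t : ℕ) (μ κ : ℂ) (hκ : κ * (∏ i, ((a i : ℂˣ) : ℂ))⁻¹ * θ = μ) :
    (Module.End.eigenspace (twistedDiagonalAction a) μ ⊓ idealDegree I (t + q)) ⊓
        (Module.End.eigenspace (twistedDiagonalAction a) κ ⊓ homogeneousSubmodule (Fin (n + 2)) ℂ t).map
          (LinearMap.mulLeft ℂ Q) =
      (Module.End.eigenspace (twistedDiagonalAction a) κ ⊓ idealDegree I t).map (LinearMap.mulLeft ℂ Q) := by
  apply le_antisymm
  · rintro _ ⟨⟨-, hfI, -⟩, r, ⟨hrκ, hrt⟩, rfl⟩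
    exact ⟨r, ⟨hrκ, hnzd r hfI, hrt⟩, rfl⟩
  · rintro _ ⟨r, ⟨hrκ, hrI, hrt⟩, rfl⟩
    refine ⟨⟨?_, I.mul_mem_left Q hrI, ?_⟩, r, ⟨hrκ, hrt⟩, rfl⟩
    · rw [SetLike.mem_coe, LinearMap.mulLeft_apply, mul_comm]
      have h := mul_mem_eigenspace_twistedDiagonalAction hrκ hQθ
      rwa [hκ] at h
    · rw [LinearMap.mulLeft_apply]
      simpa [add_comm] using hQ.mul (show r.IsHomogeneous t from hrt)

/-- **The refined non-zero-divisor formula** (Philippon's Lemme 3.1, character by character): for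
`I = (S)` generated by homogeneous `T_a`-eigenvectors and `Q ∈ E_θ(T_a)` a form of degree `q`, non-zero and a
non-zero-divisor modulo `I`,
`dim ((I + (Q))_{t+q})_μ + dim (I_t)_κ = dim (I_{t+q})_μ + dim (S_t)_κ` with `κ = μ (∏ aᵢ)/θ` (the exact
sequence `0 → (S/I)_{t,κ} →·Q (S/I)_{t+q,μ} → (S/(I,Q))_{t+q,μ} → 0`). [cite: Philippon1986, Lemme 3.1]
[cite: CarlsonMullerStachPeters2017, Thm. 7.4.1 (proof)] -/
theorem finrank_part_idealDegree_sup_span_add_eq {a : Fin (n + 2) → ℂˣ}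
    {S : Set (MvPolynomial (Fin (n + 2)) ℂ)}
    (hSe : ∀ Q ∈ S, ∃ θ, Q ∈ Module.End.eigenspace (twistedDiagonalAction a) θ)
    (hSh : ∀ Q ∈ S, ∃ k, Q.IsHomogeneous k)
    {Q : MvPolynomial (Fin (n + 2)) ℂ} (hQ0 : Q ≠ 0) {q : ℕ} (hQ : Q.IsHomogeneous q) {θ : ℂ} (hθ : θ ≠ 0)
    (hQθ : Q ∈ Module.End.eigenspace (twistedDiagonalAction a) θ)
    (hnzd : ∀ f, Q * f ∈ Ideal.span S → f ∈ Ideal.span S) (t : ℕ) (μ : ℂ) :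
    finrank ℂ ↥(Module.End.eigenspace (twistedDiagonalAction a) μ ⊓
        idealDegree (Ideal.span S ⊔ Ideal.span {Q}) (t + q)) +
      finrank ℂ ↥(Module.End.eigenspace (twistedDiagonalAction a) (μ * (∏ i, ((a i : ℂˣ) : ℂ)) * θ⁻¹) ⊓
        idealDegree (Ideal.span S) t) =
      finrank ℂ ↥(Module.End.eigenspace (twistedDiagonalAction a) μ ⊓ idealDegree (Ideal.span S) (t + q)) +
        finrank ℂ ↥(Module.End.eigenspace (twistedDiagonalAction a) (μ * (∏ i, ((a i : ℂˣ) : ℂ)) * θ⁻¹) ⊓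
          homogeneousSubmodule (Fin (n + 2)) ℂ t) := by
  set κ : ℂ := μ * (∏ i, ((a i : ℂˣ) : ℂ)) * θ⁻¹ with hκdef
  have hκ : κ * (∏ i, ((a i : ℂˣ) : ℂ))⁻¹ * θ = μ := by
    rw [hκdef]; field_simp [prod_units_val_ne_zero a, hθ]
  haveI := Literature.RingTheory.MvPolynomial.finite_homogeneousSubmodule (K := ℂ) (σ := Fin (n + 2)) t
  haveI : FiniteDimensional ℂ ↥(Module.End.eigenspace (twistedDiagonalAction a) κ ⊓
      homogeneousSubmodule (Fin (n + 2)) ℂ t) := Submodule.finiteDimensional_inf_right _ _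
  haveI : FiniteDimensional ℂ ↥(Module.End.eigenspace (twistedDiagonalAction a) κ ⊓ idealDegree (Ideal.span S) t) :=
    Submodule.finiteDimensional_inf_right _ _
  have h1 := Submodule.finrank_sup_add_finrank_inf_eq
    (Module.End.eigenspace (twistedDiagonalAction a) μ ⊓ idealDegree (Ideal.span S) (t + q))
    ((Module.End.eigenspace (twistedDiagonalAction a) κ ⊓ homogeneousSubmodule (Fin (n + 2)) ℂ t).map
      (LinearMap.mulLeft ℂ Q))
  rw [← part_idealDegree_sup_span_singleton hSe hSh hQ hθ hQθ t μ,
    Literature.RingTheory.MvPolynomial.finrank_map_mulLeft hQ0,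
    part_idealDegree_inf_map_mulLeft_eq hQ hQθ hnzd t μ κ hκ,
    Literature.RingTheory.MvPolynomial.finrank_map_mulLeft hQ0] at h1
  omega

/-- Below the degree of the new generator nothing changes: `(I + (Q))_t = I_t` for `t < deg Q`
(`I` homogeneous). [cite: Philippon1986, Lemme 3.1] -/
theorem idealDegree_sup_span_singleton_of_lt_eigen {S : Set (MvPolynomial (Fin (n + 2)) ℂ)}
    (hSh : ∀ Q ∈ S, ∃ k, Q.IsHomogeneous k) {Q : MvPolynomial (Fin (n + 2)) ℂ} {q t : ℕ}
    (hQ : Q.IsHomogeneous q) (ht : t < q) :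
    idealDegree (Ideal.span S ⊔ Ideal.span {Q}) t = idealDegree (Ideal.span S) t := by
  classical
  letI : GradedRing (homogeneousSubmodule (Fin (n + 2)) ℂ) := MvPolynomial.gradedAlgebra
  have hI : (Ideal.span S).IsHomogeneous (homogeneousSubmodule (Fin (n + 2)) ℂ) :=
    Ideal.homogeneous_span _ _ fun Q hQ ↦ hSh Q hQ
  refine le_antisymm ?_ (Literature.RingTheory.MvPolynomial.idealDegree_mono le_sup_left t)
  rintro f ⟨hf, hft⟩
  obtain ⟨i, hi, j, hj, rfl⟩ := Submodule.mem_sup.mp hf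
  obtain ⟨r, rfl⟩ := Ideal.mem_span_singleton'.mp hj
  refine ⟨?_, hft⟩
  have hcomp : homogeneousComponent t (r * Q) = 0 := by
    conv_lhs => rw [← sum_homogeneousComponent r, Finset.sum_mul, map_sum]
    refine Finset.sum_eq_zero fun m _ ↦ ?_
    have hmem : homogeneousComponent m r * Q ∈ homogeneousSubmodule (Fin (n + 2)) ℂ (m + q) :=
      (homogeneousComponent_isHomogeneous m r).mul hQ
    rw [homogeneousComponent_of_mem hmem, if_neg (by omega)]
  rw [← homogeneousComponent_eq_self hft, map_add, hcomp, add_zero]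
  exact homogeneousComponent_mem_of_mem hI hi t

/-! ### §5 Square systems of eigen-forms with finite quotient: the refined Hilbert function depends
only on the degrees and the characters -/

section Square

variable {m : ℕ}

/-- The partial ideals `(G_0, …, G_{k−1})` as spans. [folklore] -/
private theorem ofList_take_eq_span (G : Fin (m + 2) → MvPolynomial (Fin (m + 2)) ℂ) (k : ℕ) :
    Ideal.ofList ((List.ofFn G).take k) = Ideal.span {x | x ∈ (List.ofFn G).take k} := rfl

/-- `I_{k+1} = I_k + (G_k)`. [folklore] -/
private theorem ofList_take_succ_eigen (G : Fin (m + 2) → MvPolynomial (Fin (m + 2)) ℂ) {k : ℕ} (hk : k < m + 2) :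
    Ideal.ofList ((List.ofFn G).take (k + 1)) =
      Ideal.ofList ((List.ofFn G).take k) ⊔ Ideal.span {G ⟨k, hk⟩} := by
  rw [List.take_succ_eq_append_getElem (by rw [List.length_ofFn]; exact hk), Ideal.ofList_append,
    Ideal.ofList_singleton, List.getElem_ofFn]

/-- `I_{m+2} = (G)`. [folklore] -/
private theorem ofList_take_length_eigen (G : Fin (m + 2) → MvPolynomial (Fin (m + 2)) ℂ) :
    Ideal.ofList ((List.ofFn G).take (m + 2)) = Ideal.span (Set.range G) := by
  rw [List.take_of_length_le (by simp), Ideal.ofList]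
  congr 1
  ext z
  simp only [Set.mem_setOf_eq, List.mem_ofFn']

/-- Elements of `take k (ofFn G)` are among the `G i`. [folklore] -/
private theorem mem_take_ofFn {G : Fin (m + 2) → MvPolynomial (Fin (m + 2)) ℂ} {k : ℕ}
    {x : MvPolynomial (Fin (m + 2)) ℂ} (hx : x ∈ (List.ofFn G).take k) : ∃ i, G i = x :=
  (List.mem_ofFn' G x).mp (List.mem_of_mem_take hx)

/-- A generator of a square system with finite quotient is non-zero. [folklore] -/
private theorem ne_zero_of_X_pow_mem_eigen (G : Fin (m + 2) → MvPolynomial (Fin (m + 2)) ℂ) (d : Fin (m + 2) → ℕ)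
    (hG : ∀ i, (G i).IsHomogeneous (d i)) (hd : ∀ i, 0 < d i) {N : ℕ}
    (hXN : ∀ i, (X i : MvPolynomial (Fin (m + 2)) ℂ) ^ N ∈ Ideal.span (Set.range G)) (k : Fin (m + 2)) :
    G k ≠ 0 := by
  intro h0
  have h1 : (1 : MvPolynomial (Fin (m + 2)) ℂ) ∈ Ideal.ofList ((List.ofFn G).take k) :=
    mem_ofList_take_of_mul_mem G d hG hd hXN k.2 (u := 1) (by
      rw [show (⟨(k : ℕ), k.2⟩ : Fin (m + 2)) = k from rfl, h0, zero_mul]; exact Ideal.zero_mem _)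
  -- `I_k ⊆ (x_0, …)`: all generators have positive degree, so `1 ∉ I_k`
  have h2 : Ideal.ofList ((List.ofFn G).take k) ≤
      Literature.AlgebraicGeometry.Resolution.originIdeal ℂ (m + 2) := by
    refine Ideal.span_le.mpr fun x hx ↦ ?_
    obtain ⟨i, rfl⟩ := mem_take_ofFn hx
    rw [SetLike.mem_coe, Literature.AlgebraicGeometry.Resolution.mem_originIdeal_iff,
      constantCoeff_eq]
    exact (hG i).coeff_eq_zero (by rw [map_zero]; have := hd i; omega)
  have h3 := h2 h1
  rw [Literature.AlgebraicGeometry.Resolution.mem_originIdeal_iff, map_one] at h3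
  exact one_ne_zero h3

/-- **The refined Hilbert function of a square system of eigen-forms with finite quotient depends only on
the degrees and the characters** (for every partial ideal `I_k = (G_0, …, G_{k−1})`): if `G, G'` are two
families of `m + 2` forms in `m + 2` variables with the same degrees `d_i > 0`, `T_a`-eigenvectors with the
same characters `θ_i`, and both quotients `S/(G)`, `S/(G')` are finite-dimensional, then
`dim (S_t)_μ − dim ((I_k)_t)_μ = dim (S_t)_μ − dim ((I'_k)_t)_μ` for all `k, t, μ` — induction on `k` by the
refined non-zero-divisor formula, the generators being a regular sequence (tree
`mem_ofList_take_of_mul_mem`, Matsumura 17.4). [cite: CarlsonMullerStachPeters2017, Thm. 7.4.1 (proof)]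
[cite: Philippon1986, Lemme 3.1] -/
theorem refinedHilbert_ofList_take_eq_of_X_pow_mem (a : Fin (m + 2) → ℂˣ)
    (G G' : Fin (m + 2) → MvPolynomial (Fin (m + 2)) ℂ) (d : Fin (m + 2) → ℕ) (θ : Fin (m + 2) → ℂ)
    (hG : ∀ i, (G i).IsHomogeneous (d i)) (hG' : ∀ i, (G' i).IsHomogeneous (d i)) (hd : ∀ i, 0 < d i)
    (hθ : ∀ i, θ i ≠ 0) (hGθ : ∀ i, G i ∈ Module.End.eigenspace (twistedDiagonalAction a) (θ i))
    (hG'θ : ∀ i, G' i ∈ Module.End.eigenspace (twistedDiagonalAction a) (θ i))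
    {N N' : ℕ} (hXN : ∀ i, (X i : MvPolynomial (Fin (m + 2)) ℂ) ^ N ∈ Ideal.span (Set.range G))
    (hXN' : ∀ i, (X i : MvPolynomial (Fin (m + 2)) ℂ) ^ N' ∈ Ideal.span (Set.range G')) :
    ∀ k, k ≤ m + 2 → ∀ (t : ℕ) (μ : ℂ),
      finrank ℂ ↥(Module.End.eigenspace (twistedDiagonalAction a) μ ⊓ homogeneousSubmodule (Fin (m + 2)) ℂ t) -
          finrank ℂ ↥(Module.End.eigenspace (twistedDiagonalAction a) μ ⊓
            idealDegree (Ideal.ofList ((List.ofFn G).take k)) t) =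
        finrank ℂ ↥(Module.End.eigenspace (twistedDiagonalAction a) μ ⊓ homogeneousSubmodule (Fin (m + 2)) ℂ t) -
          finrank ℂ ↥(Module.End.eigenspace (twistedDiagonalAction a) μ ⊓
            idealDegree (Ideal.ofList ((List.ofFn G').take k)) t) := by
  -- data about the partial ideals as spans of eigen-forms
  have hSe : ∀ k, ∀ Q ∈ {x | x ∈ (List.ofFn G).take k}, ∃ θ', Q ∈ Module.End.eigenspace (twistedDiagonalAction a) θ' :=
    fun _ Q hQ ↦ by obtain ⟨i, rfl⟩ := mem_take_ofFn hQ; exact ⟨θ i, hGθ i⟩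
  have hSe' : ∀ k, ∀ Q ∈ {x | x ∈ (List.ofFn G').take k}, ∃ θ', Q ∈ Module.End.eigenspace (twistedDiagonalAction a) θ' :=
    fun _ Q hQ ↦ by obtain ⟨i, rfl⟩ := mem_take_ofFn hQ; exact ⟨θ i, hG'θ i⟩
  have hSh : ∀ k, ∀ Q ∈ {x | x ∈ (List.ofFn G).take k}, ∃ e, Q.IsHomogeneous e :=
    fun _ Q hQ ↦ by obtain ⟨i, rfl⟩ := mem_take_ofFn hQ; exact ⟨d i, hG i⟩
  have hSh' : ∀ k, ∀ Q ∈ {x | x ∈ (List.ofFn G').take k}, ∃ e, Q.IsHomogeneous e :=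
    fun _ Q hQ ↦ by obtain ⟨i, rfl⟩ := mem_take_ofFn hQ; exact ⟨d i, hG' i⟩
  -- finite-dimensionality bound used to justify truncated subtraction
  have hle : ∀ (I : Ideal (MvPolynomial (Fin (m + 2)) ℂ)) (t : ℕ) (μ : ℂ),
      finrank ℂ ↥(Module.End.eigenspace (twistedDiagonalAction a) μ ⊓ idealDegree I t) ≤
        finrank ℂ ↥(Module.End.eigenspace (twistedDiagonalAction a) μ ⊓ homogeneousSubmodule (Fin (m + 2)) ℂ t) := by
    intro I t μ
    haveI := Literature.RingTheory.MvPolynomial.finite_homogeneousSubmodule (K := ℂ) (σ := Fin (m + 2)) t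
    haveI : FiniteDimensional ℂ ↥(Module.End.eigenspace (twistedDiagonalAction a) μ ⊓
        homogeneousSubmodule (Fin (m + 2)) ℂ t) := Submodule.finiteDimensional_inf_right _ _
    exact Submodule.finrank_mono (inf_le_inf_left _ (Literature.RingTheory.MvPolynomial.idealDegree_le_homogeneousSubmodule I t))
  intro k
  induction k with
  | zero => intro _ t μ; rfl
  | succ k ih =>
    intro hk t μ
    have hk' : k < m + 2 := by omega
    rw [ofList_take_succ_eigen G hk', ofList_take_succ_eigen G' hk', ofList_take_eq_span G k, ofList_take_eq_span G' k]
    by_cases ht : t < d ⟨k, hk'⟩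
    · rw [idealDegree_sup_span_singleton_of_lt_eigen (hSh k) (hG ⟨k, hk'⟩) ht,
        idealDegree_sup_span_singleton_of_lt_eigen (hSh' k) (hG' ⟨k, hk'⟩) ht]
      exact ih hk'.le t μ
    · obtain ⟨t', rfl⟩ : ∃ t', t = t' + d ⟨k, hk'⟩ := ⟨t - d ⟨k, hk'⟩, by omega⟩
      have h1 := finrank_part_idealDegree_sup_span_add_eq (hSe k) (hSh k)
        (ne_zero_of_X_pow_mem_eigen G d hG hd hXN ⟨k, hk'⟩) (hG ⟨k, hk'⟩) (hθ ⟨k, hk'⟩) (hGθ ⟨k, hk'⟩)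
        (fun f hf ↦ mem_ofList_take_of_mul_mem G d hG hd hXN hk' hf) t' μ
      have h2 := finrank_part_idealDegree_sup_span_add_eq (hSe' k) (hSh' k)
        (ne_zero_of_X_pow_mem_eigen G' d hG' hd hXN' ⟨k, hk'⟩) (hG' ⟨k, hk'⟩) (hθ ⟨k, hk'⟩) (hG'θ ⟨k, hk'⟩)
        (fun f hf ↦ mem_ofList_take_of_mul_mem G' d hG' hd hXN' hk' hf) t' μ
      have h3 := ih hk'.le t' (μ * (∏ i, ((a i : ℂˣ) : ℂ)) * (θ ⟨k, hk'⟩)⁻¹)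
      have h4 := ih hk'.le (t' + d ⟨k, hk'⟩) μ
      rw [ofList_take_eq_span G k] at h3 h4
      rw [ofList_take_eq_span G' k] at h3 h4
      have b1 := hle (Ideal.span {x | x ∈ (List.ofFn G).take k} ⊔ Ideal.span {G ⟨k, hk'⟩}) (t' + d ⟨k, hk'⟩) μ
      have b2 := hle (Ideal.span {x | x ∈ (List.ofFn G').take k} ⊔ Ideal.span {G' ⟨k, hk'⟩}) (t' + d ⟨k, hk'⟩) μ
      have b3 := hle (Ideal.span {x | x ∈ (List.ofFn G).take k}) t' (μ * (∏ i, ((a i : ℂˣ) : ℂ)) * (θ ⟨k, hk'⟩)⁻¹)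
      have b4 := hle (Ideal.span {x | x ∈ (List.ofFn G').take k}) t' (μ * (∏ i, ((a i : ℂˣ) : ℂ)) * (θ ⟨k, hk'⟩)⁻¹)
      have b5 := hle (Ideal.span {x | x ∈ (List.ofFn G).take k}) (t' + d ⟨k, hk'⟩) μ
      have b6 := hle (Ideal.span {x | x ∈ (List.ofFn G').take k}) (t' + d ⟨k, hk'⟩) μ
      omega

/-- **The refined Hilbert function of `(G)` depends only on degrees and characters** (full ideal).
[cite: CarlsonMullerStachPeters2017, Thm. 7.4.1 (proof)] [cite: Philippon1986, Lemme 3.1] -/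
theorem refinedHilbert_span_eq_of_X_pow_mem (a : Fin (m + 2) → ℂˣ)
    (G G' : Fin (m + 2) → MvPolynomial (Fin (m + 2)) ℂ) (d : Fin (m + 2) → ℕ) (θ : Fin (m + 2) → ℂ)
    (hG : ∀ i, (G i).IsHomogeneous (d i)) (hG' : ∀ i, (G' i).IsHomogeneous (d i)) (hd : ∀ i, 0 < d i)
    (hθ : ∀ i, θ i ≠ 0) (hGθ : ∀ i, G i ∈ Module.End.eigenspace (twistedDiagonalAction a) (θ i))
    (hG'θ : ∀ i, G' i ∈ Module.End.eigenspace (twistedDiagonalAction a) (θ i))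
    {N N' : ℕ} (hXN : ∀ i, (X i : MvPolynomial (Fin (m + 2)) ℂ) ^ N ∈ Ideal.span (Set.range G))
    (hXN' : ∀ i, (X i : MvPolynomial (Fin (m + 2)) ℂ) ^ N' ∈ Ideal.span (Set.range G')) (t : ℕ) (μ : ℂ) :
    finrank ℂ ↥(Module.End.eigenspace (twistedDiagonalAction a) μ ⊓ homogeneousSubmodule (Fin (m + 2)) ℂ t) -
        finrank ℂ ↥(Module.End.eigenspace (twistedDiagonalAction a) μ ⊓ idealDegree (Ideal.span (Set.range G)) t) =
      finrank ℂ ↥(Module.End.eigenspace (twistedDiagonalAction a) μ ⊓ homogeneousSubmodule (Fin (m + 2)) ℂ t) -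
        finrank ℂ ↥(Module.End.eigenspace (twistedDiagonalAction a) μ ⊓ idealDegree (Ideal.span (Set.range G')) t) := by
  have h := refinedHilbert_ofList_take_eq_of_X_pow_mem a G G' d θ hG hG' hd hθ hGθ hG'θ hXN hXN' (m + 2) le_rfl t μ
  rwa [ofList_take_length_eigen G, ofList_take_length_eigen G'] at h

end Square

/-! ### §6 The monomial complete intersection `(x_i^e)`: eigen-parts are spanned by monomials -/

/-- Membership in `univ.finsuppAntidiag t` is having degree `t`. [folklore] -/
private theorem mem_finsuppAntidiag_univ_iff_eigen {t : ℕ} {β : Fin (n + 2) →₀ ℕ} :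
    β ∈ (Finset.univ : Finset (Fin (n + 2))).finsuppAntidiag t ↔ β.degree = t := by
  simp [Finset.mem_finsuppAntidiag, Finsupp.degree_eq_sum]

/-- **The `μ`-part of `S_t` is the space of polynomials supported on the exponents of degree `t` and
character `μ`** (a coordinate subspace with its monomial basis). [cite: Shioda1979HodgeFermat, §1 (1.7)] -/
theorem eigenspace_inf_homogeneousSubmodule_eq_restrictSupport (a : Fin (n + 2) → ℂˣ) (μ : ℂ) (t : ℕ) :
    Module.End.eigenspace (twistedDiagonalAction a) μ ⊓ homogeneousSubmodule (Fin (n + 2)) ℂ t =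
      restrictSupport ℂ {β : Fin (n + 2) →₀ ℕ | β.degree = t ∧ diagonalCharacter a β = μ} := by
  ext P
  rw [mem_eigenspace_inf_homogeneousSubmodule_iff, mem_restrictSupport_iff]
  constructor
  · rintro ⟨ht, hμ⟩ β hβ
    refine ⟨?_, hμ β hβ⟩
    rw [Finsupp.degree_eq_weight_one]
    exact ht (mem_support_iff.mp hβ)
  · intro h
    refine ⟨fun β hβ ↦ ?_, fun β hβ ↦ (h hβ).2⟩
    have h1 := (h (mem_support_iff.mpr hβ)).1
    rw [Finsupp.degree_eq_weight_one] at h1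
    exact h1

/-- `(x_i^e) = (monomials x^{e·1_i})`. [folklore] -/
private theorem span_X_pow_eq_span_monomial (e : ℕ) :
    Ideal.span (Set.range fun i : Fin (n + 2) ↦ (X i : MvPolynomial (Fin (n + 2)) ℂ) ^ e) =
      Ideal.span ((fun s ↦ monomial s (1 : ℂ)) '' Set.range fun i : Fin (n + 2) ↦ Finsupp.single i e) := by
  congr 1
  ext P
  constructor
  · rintro ⟨i, rfl⟩
    exact ⟨Finsupp.single i e, ⟨i, rfl⟩, X_pow_eq_monomial.symm⟩
  · rintro ⟨_, ⟨i, rfl⟩, rfl⟩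
    exact ⟨i, X_pow_eq_monomial⟩

/-- **The `μ`-part of the degree-`t` piece of the monomial ideal `(x_0^e, …, x_{n+1}^e)`** is the space of
polynomials supported on exponents of degree `t`, character `μ`, divisible by some `x_i^e`. [cite: Movasati2016Periods, Definition 1] -/
theorem eigenspace_inf_idealDegree_span_X_pow_eq_restrictSupport (a : Fin (n + 2) → ℂˣ) (μ : ℂ) (t e : ℕ) :
    Module.End.eigenspace (twistedDiagonalAction a) μ ⊓
        idealDegree (Ideal.span (Set.range fun i : Fin (n + 2) ↦ (X i : MvPolynomial (Fin (n + 2)) ℂ) ^ e)) t =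
      restrictSupport ℂ {β : Fin (n + 2) →₀ ℕ | β.degree = t ∧ diagonalCharacter a β = μ ∧ ∃ i, e ≤ β i} := by
  ext P
  rw [mem_eigenspace_inf_idealDegree_iff, mem_restrictSupport_iff, span_X_pow_eq_span_monomial,
    mem_ideal_span_monomial_image]
  constructor
  · rintro ⟨hI, ht, hμ⟩ β hβ
    refine ⟨?_, hμ β hβ, ?_⟩
    · rw [Finsupp.degree_eq_weight_one]
      exact ht (mem_support_iff.mp hβ)
    · obtain ⟨_, ⟨i, rfl⟩, hle⟩ := hI β hβ
      exact ⟨i, Finsupp.single_le_iff.mp hle⟩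
  · intro h
    refine ⟨fun β hβ ↦ ?_, fun β hβ ↦ ?_, fun β hβ ↦ (h hβ).2.1⟩
    · obtain ⟨i, hi⟩ := (h hβ).2.2
      exact ⟨Finsupp.single i e, ⟨i, rfl⟩, Finsupp.single_le_iff.mpr hi⟩
    · have h1 := (h (mem_support_iff.mpr hβ)).1
      rw [Finsupp.degree_eq_weight_one] at h1
      exact h1

/-- The dimension of a coordinate subspace cut out by a finite set of exponents is its cardinality
(the monomial basis `basisRestrictSupport`). [folklore] -/
private theorem finrank_restrictSupport_finsetCoe (D : Finset (Fin (n + 2) →₀ ℕ)) :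
    finrank ℂ ↥(restrictSupport ℂ (↑D : Set (Fin (n + 2) →₀ ℕ))) = D.card := by
  exact (Module.finrank_eq_card_basis (basisRestrictSupport ℂ (↑D : Set (Fin (n + 2) →₀ ℕ)))).trans (by simp)

/-- **`dim (S_t)_μ` is the number of exponents of degree `t` and character `μ`.** [cite: Shioda1979HodgeFermat, §1 (1.7)] -/
theorem finrank_eigenspace_inf_homogeneousSubmodule_eq_card (a : Fin (n + 2) → ℂˣ) (μ : ℂ) (t : ℕ) :
    finrank ℂ ↥(Module.End.eigenspace (twistedDiagonalAction a) μ ⊓ homogeneousSubmodule (Fin (n + 2)) ℂ t) =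
      (((Finset.univ : Finset (Fin (n + 2))).finsuppAntidiag t).filter
        fun β ↦ diagonalCharacter a β = μ).card := by
  classical
  have hset : {β : Fin (n + 2) →₀ ℕ | β.degree = t ∧ diagonalCharacter a β = μ} =
      ↑(((Finset.univ : Finset (Fin (n + 2))).finsuppAntidiag t).filter fun β ↦ diagonalCharacter a β = μ) := by
    ext β
    rw [Set.mem_setOf_eq, Finset.coe_filter, Set.mem_setOf_eq, mem_finsuppAntidiag_univ_iff_eigen]
  rw [eigenspace_inf_homogeneousSubmodule_eq_restrictSupport, hset, finrank_restrictSupport_finsetCoe]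

/-- **`dim ((x_i^e)_t)_μ` is the number of exponents of degree `t`, character `μ`, with some `β_i ≥ e`.** [cite: Movasati2016Periods, Definition 1] -/
theorem finrank_eigenspace_inf_idealDegree_span_X_pow_eq_card (a : Fin (n + 2) → ℂˣ) (μ : ℂ) (t e : ℕ) :
    finrank ℂ ↥(Module.End.eigenspace (twistedDiagonalAction a) μ ⊓
        idealDegree (Ideal.span (Set.range fun i : Fin (n + 2) ↦ (X i : MvPolynomial (Fin (n + 2)) ℂ) ^ e)) t) =
      (((Finset.univ : Finset (Fin (n + 2))).finsuppAntidiag t).filter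
        fun β ↦ diagonalCharacter a β = μ ∧ ∃ i, e ≤ β i).card := by
  classical
  have hset : {β : Fin (n + 2) →₀ ℕ | β.degree = t ∧ diagonalCharacter a β = μ ∧ ∃ i, e ≤ β i} =
      ↑(((Finset.univ : Finset (Fin (n + 2))).finsuppAntidiag t).filter
        fun β ↦ diagonalCharacter a β = μ ∧ ∃ i, e ≤ β i) := by
    ext β
    rw [Set.mem_setOf_eq, Finset.coe_filter, Set.mem_setOf_eq, mem_finsuppAntidiag_univ_iff_eigen]
  rw [eigenspace_inf_idealDegree_span_X_pow_eq_restrictSupport, hset, finrank_restrictSupport_finsetCoe]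

/-- **The refined Hilbert function of the monomial complete intersection `(x_0^e, …, x_{n+1}^e)`** (`e ≥ 1`) is
the box count by characters: `dim (S_t)_μ − dim ((x^e)_t)_μ = #{β : |β| = t, β_i ≤ e − 1, χ_a(β) = μ}`
(the monomials `x^β`, `β_i < e`, are a `T_a`-eigenbasis of the quotient). [cite: Movasati2016Periods, Definition 1]
[cite: Shioda1979HodgeFermat, §1 (1.7)] -/
theorem refinedHilbert_span_X_pow_eq_card (a : Fin (n + 2) → ℂˣ) (μ : ℂ) (t : ℕ) {e : ℕ} (he : 1 ≤ e) :
    finrank ℂ ↥(Module.End.eigenspace (twistedDiagonalAction a) μ ⊓ homogeneousSubmodule (Fin (n + 2)) ℂ t) -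
        finrank ℂ ↥(Module.End.eigenspace (twistedDiagonalAction a) μ ⊓
          idealDegree (Ideal.span (Set.range fun i : Fin (n + 2) ↦ (X i : MvPolynomial (Fin (n + 2)) ℂ) ^ e)) t) =
      (((Finset.univ : Finset (Fin (n + 2))).finsuppAntidiag t).filter
        fun β ↦ (∀ i, β i ≤ e - 1) ∧ diagonalCharacter a β = μ).card := by
  classical
  rw [finrank_eigenspace_inf_homogeneousSubmodule_eq_card, finrank_eigenspace_inf_idealDegree_span_X_pow_eq_card]
  set D := ((Finset.univ : Finset (Fin (n + 2))).finsuppAntidiag t).filter fun β ↦ diagonalCharacter a β = μ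
    with hD
  have h1 : (((Finset.univ : Finset (Fin (n + 2))).finsuppAntidiag t).filter
      fun β ↦ diagonalCharacter a β = μ ∧ ∃ i, e ≤ β i) = D.filter fun β ↦ ∃ i, e ≤ β i := by
    rw [hD, Finset.filter_filter]
  have h2 : (((Finset.univ : Finset (Fin (n + 2))).finsuppAntidiag t).filter
      fun β ↦ (∀ i, β i ≤ e - 1) ∧ diagonalCharacter a β = μ) = D.filter fun β ↦ ¬ ∃ i, e ≤ β i := by
    rw [hD, Finset.filter_filter]
    refine Finset.filter_congr fun β _ ↦ ?_
    simp only [not_exists, not_le]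
    constructor
    · rintro ⟨h, hμ⟩; exact ⟨hμ, fun i ↦ by have := h i; omega⟩
    · rintro ⟨hμ, h⟩; exact ⟨fun i ↦ by have := h i; omega, hμ⟩
  rw [h1, h2]
  have := Finset.card_filter_add_card_filter_not (s := D) (fun β : Fin (n + 2) →₀ ℕ ↦ ∃ i, e ≤ β i)
  omega

/-! ### §7 The Jacobian ideal of a form with a diagonal symmetry -/

/-- The partials of an `a`-invariant form are `T_a`-eigenvectors: `T_a(∂ᵢF) = (∏ aⱼ) aᵢ⁻¹ · ∂ᵢF`.
[cite: VoisinHodgeII2003, §6.1.3 Def. 6.9 (held text chunk p0159)] -/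
theorem pderiv_mem_eigenspace_twistedDiagonalAction {F : MvPolynomial (Fin (n + 2)) ℂ}
    {a : Fin (n + 2) → ℂˣ} (ha : a ∈ diagonalStabilizer F) (i : Fin (n + 2)) :
    pderiv i F ∈ Module.End.eigenspace (twistedDiagonalAction a)
      ((∏ j, ((a j : ℂˣ) : ℂ)) * ((a i : ℂˣ) : ℂ)⁻¹) := by
  rw [Module.End.mem_eigenspace_iff, twistedDiagonalAction_apply,
    aeval_diagonalSubst_pderiv_of_mem_diagonalStabilizer ha i, Units.smul_def, Units.val_inv_eq_inv_val,
    smul_smul]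

/-- A power of a variable is a `T_a`-eigenvector: `T_a(x_i^e) = (∏ aⱼ) aᵢ^e · x_i^e`. [cite: Shioda1979HodgeFermat, §1 (1.7)] -/
theorem X_pow_mem_eigenspace_twistedDiagonalAction (a : Fin (n + 2) → ℂˣ) (i : Fin (n + 2)) (e : ℕ) :
    (X i : MvPolynomial (Fin (n + 2)) ℂ) ^ e ∈ Module.End.eigenspace (twistedDiagonalAction a)
      ((∏ j, ((a j : ℂˣ) : ℂ)) * ((a i : ℂˣ) : ℂ) ^ e) := by
  classical
  rw [X_pow_eq_monomial]
  have h := monomial_mem_eigenspace_twistedDiagonalAction a (Finsupp.single i e) 1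
  have hχ : diagonalCharacter a (Finsupp.single i e) = (∏ j, ((a j : ℂˣ) : ℂ)) * ((a i : ℂˣ) : ℂ) ^ e := by
    rw [diagonalCharacter_eq_prod_mul]
    congr 1
    rw [← Finset.mul_prod_erase Finset.univ _ (Finset.mem_univ i), Finsupp.single_eq_same,
      Finset.prod_eq_one (fun j hj ↦ by rw [Finsupp.single_eq_of_ne (Finset.ne_of_mem_erase hj), pow_zero]),
      mul_one]
  rwa [hχ] at h

/-- **The equivariant Hilbert function of the Jacobian ring of a form with a diagonal symmetry** (refined
Macaulay / Movasati's `#I_a` by characters): let `F` be a form of degree `d ≥ 2` in `n + 2` variables with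
finite-dimensional Jacobian ring (a power of every variable in `J_F`: every smooth hypersurface), invariant
under the diagonal symmetry `a` with `aᵢ^d = 1` for all `i`. Then for every degree `t` and every `μ`,
`dim (S_t)_μ − dim ((J_F)_t)_μ = #{β : |β| = t, 0 ≤ β_i ≤ d − 2, χ_a(β) = μ}`: the `T_a`-eigen-parts of the
Jacobian ring `R_F = S/J_F` have the dimensions of those of the Fermat/monomial model `(x_i^{d−1})` (same
degrees, same characters `(∏ aⱼ) aᵢ⁻¹ = (∏ aⱼ) aᵢ^{d−1}`), whose quotient has the monomial eigenbasis
`x^β`, `β_i ≤ d − 2`. [cite: CarlsonMullerStachPeters2017, Thm. 7.4.1 (proof)] [cite: Movasati2016Periods, Definition 1] -/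
theorem refinedHilbert_jacobianIdeal_eq_card {d : ℕ} (hd : 2 ≤ d) {F : MvPolynomial (Fin (n + 2)) ℂ}
    (hF : F.IsHomogeneous d) {a : Fin (n + 2) → ℂˣ} (ha : a ∈ diagonalStabilizer F)
    (had : ∀ i, (a i) ^ d = 1) {M : ℕ}
    (hXM : ∀ i, (X i : MvPolynomial (Fin (n + 2)) ℂ) ^ M ∈ UniversalHypersurface.jacobianIdeal F)
    (t : ℕ) (μ : ℂ) :
    finrank ℂ ↥(Module.End.eigenspace (twistedDiagonalAction a) μ ⊓ homogeneousSubmodule (Fin (n + 2)) ℂ t) -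
        finrank ℂ ↥(Module.End.eigenspace (twistedDiagonalAction a) μ ⊓
          idealDegree (UniversalHypersurface.jacobianIdeal F) t) =
      (((Finset.univ : Finset (Fin (n + 2))).finsuppAntidiag t).filter
        fun β ↦ (∀ i, β i ≤ d - 2) ∧ diagonalCharacter a β = μ).card := by
  have hθ : ∀ i : Fin (n + 2), (∏ j, ((a j : ℂˣ) : ℂ)) * ((a i : ℂˣ) : ℂ)⁻¹ ≠ 0 := fun i ↦
    mul_ne_zero (prod_units_val_ne_zero a) (inv_ne_zero (Units.ne_zero _))
  have hinv : ∀ i : Fin (n + 2), ((a i : ℂˣ) : ℂ) ^ (d - 1) = ((a i : ℂˣ) : ℂ)⁻¹ := by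
    intro i
    have h1 : ((a i : ℂˣ) : ℂ) ^ d = 1 := by rw [← Units.val_pow_eq_pow_val, had i, Units.val_one]
    have h2 : ((a i : ℂˣ) : ℂ) ^ (d - 1) * ((a i : ℂˣ) : ℂ) = 1 := by
      rw [← pow_succ, Nat.sub_add_cancel (by omega), h1]
    exact eq_inv_of_mul_eq_one_left h2
  have h := refinedHilbert_span_eq_of_X_pow_mem a (fun j ↦ pderiv j F)
    (fun j ↦ (X j : MvPolynomial (Fin (n + 2)) ℂ) ^ (d - 1)) (fun _ ↦ d - 1)
    (fun i ↦ (∏ j, ((a j : ℂˣ) : ℂ)) * ((a i : ℂˣ) : ℂ)⁻¹)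
    (fun j ↦ hF.pderiv) (fun j ↦ isHomogeneous_X_pow j (d - 1)) (fun _ ↦ by omega) hθ
    (fun i ↦ pderiv_mem_eigenspace_twistedDiagonalAction ha i)
    (fun i ↦ by rw [← hinv i]; exact X_pow_mem_eigenspace_twistedDiagonalAction a i (d - 1))
    hXM (N' := d - 1) (fun i ↦ Ideal.subset_span ⟨i, rfl⟩) t μ
  rw [show UniversalHypersurface.jacobianIdeal F = Ideal.span (Set.range fun j ↦ pderiv j F) from rfl, h,
    refinedHilbert_span_X_pow_eq_card a μ t (e := d - 1) (by omega)]
  rfl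

/-! ### §8 Smooth forms: the Jacobian ring is finite-dimensional (Euler + Nullstellensatz) -/

/-- **The partials of a nonsingular form of positive degree have no common non-trivial zero** (Euler's
identity `Σ xᵢ ∂ᵢF = d·F`: a common zero of the partials is a zero of `F`, hence a singular point).
[cite: VoisinHodgeII2003, §6.2.2 before Def. 6.18 (held text chunk p0165)] -/
theorem eq_zero_of_forall_eval_pderiv_eq_zero {d : ℕ} (hd : 0 < d) {F : MvPolynomial (Fin (n + 2)) ℂ}
    (hF : F.IsHomogeneous d) (hns : SmoothHypersurface.IsNonsingularForm ℂ F) (z : Fin (n + 2) → ℂ)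
    (hz : ∀ j, MvPolynomial.eval z (pderiv j F) = 0) : z = 0 := by
  by_contra hz0
  have hFz : MvPolynomial.eval z F = 0 := by
    have h := congr_arg (MvPolynomial.eval z) hF.sum_X_mul_pderiv
    rw [map_sum, map_nsmul] at h
    simp only [map_mul, eval_X, hz, mul_zero, Finset.sum_const_zero] at h
    have h' : (d : ℂ) * MvPolynomial.eval z F = 0 := by rw [nsmul_eq_mul] at h; exact h.symm
    exact (mul_eq_zero.mp h').resolve_left (Nat.cast_ne_zero.mpr (by omega))
  obtain ⟨j, hj⟩ := SmoothHypersurface.IsNonsingularForm.exists_eval_pderiv_ne_zero hns hz0 hFz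
  exact hj (hz j)

/-- **A nonsingular form has a finite-dimensional Jacobian ring**: some power of every variable lies in
`J_F` (Hilbert's Nullstellensatz; Voisin II §6.2.2 "`J^k = S^k` for sufficiently large `k`, so that `R` is an
Artinian ring"). Same statement as `exists_X_pow_mem_jacobianIdeal_of_forall_eval_pderiv` of
`CyclicCoverEigenHodgeNumbers` (kept out of the import cone). [cite: VoisinHodgeII2003, §6.2.2 before Def. 6.18 (held text chunk p0165)] -/
theorem exists_X_pow_mem_jacobianIdeal_of_isNonsingularForm {d : ℕ} (hd : 0 < d)
    {F : MvPolynomial (Fin (n + 2)) ℂ} (hF : F.IsHomogeneous d) (hns : SmoothHypersurface.IsNonsingularForm ℂ F) :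
    ∃ M, 0 < M ∧ ∀ l, (X l : MvPolynomial (Fin (n + 2)) ℂ) ^ M ∈ UniversalHypersurface.jacobianIdeal F := by
  have hrad : ∀ l, (X l : MvPolynomial (Fin (n + 2)) ℂ) ∈ (UniversalHypersurface.jacobianIdeal F).radical := by
    intro l
    rw [← MvPolynomial.vanishingIdeal_zeroLocus_eq_radical (K := ℂ), MvPolynomial.mem_vanishingIdeal_iff]
    intro x hx
    have hx0 : x = 0 := eq_zero_of_forall_eval_pderiv_eq_zero hd hF hns x fun j ↦
      hx _ (UniversalHypersurface.pderiv_mem_jacobianIdeal F j)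
    rw [hx0, MvPolynomial.aeval_X, Pi.zero_apply]
  choose N hN using hrad
  refine ⟨Finset.univ.sup N + 1, Nat.succ_pos _, fun l ↦ Ideal.pow_mem_of_pow_mem _ (hN l) ?_⟩
  have := Finset.le_sup (f := N) (Finset.mem_univ l)
  omega

/-! ### §9 The sign involution of a quinary form: the eigen-Hodge numbers are equivariant box counts -/

/-- `(−1)^m = (−1)^j ↔ m ≡ j (mod 2)` in `ℂ`. [folklore] -/
private theorem neg_one_pow_eq_neg_one_pow_iff (m j : ℕ) : ((-1 : ℂ) ^ m = (-1) ^ j) ↔ m % 2 = j % 2 := by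
  constructor
  · intro h
    rcases Nat.even_or_odd m with h1 | h1 <;> rcases Nat.even_or_odd j with h2 | h2
    · rw [Nat.even_iff.mp h1, Nat.even_iff.mp h2]
    · rw [h1.neg_one_pow, h2.neg_one_pow] at h; norm_num at h
    · rw [h1.neg_one_pow, h2.neg_one_pow] at h; norm_num at h
    · rw [Nat.odd_iff.mp h1, Nat.odd_iff.mp h2]
  · intro h
    rcases Nat.even_or_odd m with h1 | h1 <;> rcases Nat.even_or_odd j with h2 | h2
    · rw [h1.neg_one_pow, h2.neg_one_pow]
    · rw [Nat.even_iff.mp h1, Nat.odd_iff.mp h2] at h; exact absurd h (by norm_num)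
    · rw [Nat.odd_iff.mp h1, Nat.even_iff.mp h2] at h; exact absurd h (by norm_num)
    · rw [h1.neg_one_pow, h2.neg_one_pow]

/-- **The equivariant Hilbert function of the Jacobian ring of an `ι`-invariant nonsingular quinary form of
even degree**: `dim (S_k)_{(−1)^j} − dim ((J_f)_k)_{(−1)^j} = #{β ∈ [0, d−2]⁵ : |β| = k, β₀ + β₁ ≡ j (mod 2)}`
— the closed form behind the stub's `shn d j q` (coefficient of `t^k s^j` in
`(Σ_{i<d−1} (st)^i)² (Σ_{i<d−1} t^i)³`). [cite: CarlsonMullerStachPeters2017, Thm. 7.4.1 (proof)]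
[cite: Movasati2016Periods, Definition 1] -/
theorem refinedHilbert_jacobianIdeal_sign_eq_card {d : ℕ} (hd : 2 ≤ d) (hev : Even d)
    (f : MvPolynomial (Fin 5) ℂ) (hf : f.IsHomogeneous d) (hns : SmoothHypersurface.IsNonsingularForm ℂ f)
    (ha : (fun i : Fin 5 ↦ if (i : ℕ) < 2 then (-1 : ℂˣ) else 1) ∈ diagonalStabilizer f) (k j : ℕ) :
    finrank ℂ ↥(Module.End.eigenspace (twistedDiagonalAction signInvolutionVector) ((-1 : ℂ) ^ j) ⊓
          homogeneousSubmodule (Fin 5) ℂ k) -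
        finrank ℂ ↥(Module.End.eigenspace (twistedDiagonalAction signInvolutionVector) ((-1 : ℂ) ^ j) ⊓
          idealDegree (UniversalHypersurface.jacobianIdeal f) k) =
      (((Finset.univ : Finset (Fin 5)).finsuppAntidiag k).filter
        fun β ↦ (∀ i, β i ≤ d - 2) ∧ (β 0 + β 1) % 2 = j % 2).card := by
  obtain ⟨M, -, hM⟩ := exists_X_pow_mem_jacobianIdeal_of_isNonsingularForm (n := 3) (by omega) hf hns
  have ha' : signInvolutionVector ∈ diagonalStabilizer f := ha
  have had : ∀ i : Fin 5, (signInvolutionVector i) ^ d = 1 := by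
    intro i
    rw [signInvolutionVector]
    split_ifs
    · exact hev.neg_one_pow
    · exact one_pow d
  have h := refinedHilbert_jacobianIdeal_eq_card (n := 3) hd hf ha' had hM k ((-1 : ℂ) ^ j)
  refine h.trans ?_
  refine congr_arg Finset.card (Finset.filter_congr fun β _ ↦ ?_)
  rw [diagonalCharacter_signInvolutionVector, neg_one_pow_eq_neg_one_pow_iff]

/-- **The eigen-Hodge numbers of the sign involution are the equivariant box counts of the Jacobian
ring** — the two files assembled, in the binder shape of `stub_signDeckHodge` (granted the kernel package
`Griffiths1969_residueKernel_eq_jacobianIdeal`): for a nonsingular `ι`-invariant quinary form `f` of even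
degree `d`, `X_f = V₊(f) ⊂ ℙ⁴` smooth projective, `σ = diagonalAut f ha`, `q ≤ 3`, `k + 5 = (q+1) d`:
`dim_ℂ (ker(σ^* ⊗ ℂ − (−1)^j) ∩ H^{3−q,q}(X_f)) = #{β ∈ [0, d−2]⁵ : |β| = k, β₀ + β₁ ≡ j (mod 2)}`.
[cite: VoisinHodgeII2003, §6.1.3 Thm. 6.10 and Cor. 6.12 (held text chunks p0159, p0161)]
[cite: CarlsonMullerStachPeters2017, Thm. 7.4.1 (proof)] -/
theorem finrank_signEigenspace_inf_piece_eq_card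
    (hG : Griffiths1969_residueKernel_eq_jacobianIdeal)
    (hHD : exists_isReal_hodgeModel) (hI : hodgePQ_independent_of_hodgeModel) {d : ℕ} (hev : Even d)
    (f : MvPolynomial (Fin 5) ℂ) (hf : f.IsHomogeneous d) (hns : SmoothHypersurface.IsNonsingularForm ℂ f)
    (hXF : IsSmoothProjective 3 (SmoothHypersurface.hypersurface f))
    (ha : (fun i : Fin 5 ↦ if (i : ℕ) < 2 then (-1 : ℂˣ) else 1) ∈ diagonalStabilizer f)
    (j : ℕ) {q k : ℕ} (hq : q ≤ 3) (hk : k + 5 = (q + 1) * d) :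
    Module.finrank ℂ ↥(Module.End.eigenspace ((BettiUniverse.pull (diagonalAut f ha) 3).baseChange ℂ)
        ((-1 : ℂ) ^ j) ⊓ (BettiUniverse.hodge hHD hXF 3).piece ((3 : ℤ) - q) q) =
      (((Finset.univ : Finset (Fin 5)).finsuppAntidiag k).filter
        fun β ↦ (∀ i, β i ≤ d - 2) ∧ (β 0 + β 1) % 2 = j % 2).card := by
  have hd : 2 ≤ d := by
    rcases Nat.lt_or_ge d 2 with h | h
    · interval_cases d <;> omega
    · exact h
  rw [finrank_signEigenspace_inf_piece_eq_of_residueKernel hG hHD hI f hf hns hXF ha j hq hk,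
    refinedHilbert_jacobianIdeal_sign_eq_card hd hev f hf hns ha k j]

end HodgeTheory

end Literature.AlgebraicGeometry.HodgeTheory

end
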